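import Literature.Computability.AlgebraicComplexity.SmallFormatRankNormalization
import Literature.Computability.AlgebraicComplexity.KroneckerRank
import HarnessLib

/-!
# The Lafon–Winograd lower bound `R(⟨m,n,p⟩) ≥ (m + p)n + p − n − 1` over every field
(Bürgisser–Clausen–Shokrollahi 1997, Thm. (17.12)) — proof for the rank, and the small-format table

Topic `Literature/Computability/AlgebraicComplexity` (bilinear complexity; small formats).

Bürgisser–Clausen–Shokrollahi, *Algebraic Complexity Theory* (1997), Thm. (17.12) (Lafon and
Winograd): "For integers `m, n, p ≥ 2` we have `L(⟨m,n,p⟩) ≥ (m+p)n + p − n − 1`", where `L` is the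
multiplicative complexity (length of an optimal quadratic computation) and `⟨m,n,p⟩` the bilinear
map `k^{m×n} × k^{n×p} → k^{m×p}` over an arbitrary field `k`. Since `R ≥ L` (BCS (14.8)), the same
number bounds the rank `R(⟨m,n,p⟩)` = `tensorRank (matMulTensor k m n p)`
(`MatrixMultiplicationExponent.lean`). THIS FILE PROVES THE RANK STATEMENT over every field:

* `LafonWinograd.card_ge` — every bilinear computation `β` of `⟨c,m,n⟩` (`c ≥ 2`, `m, n ≥ 1`; the
  tree's letters `(c,m,n)` of `mulBilin`, `SmallFormatRankFlag.lean`) has length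
  `≥ cm + m(n−1) + (n−1)`;
* `lafonWinograd_le_tensorRank_matMulTensor` — `cm + m(n−1) + (n−1) ≤ R(⟨c,m,n⟩)` over every
  field; `BCS1997_thm_17_12_rank` — the printed form `(m+p)n + p − n − 1 ≤ R(⟨m,n,p⟩)` for
  `m, n, p ≥ 2` (the two agree: `(m+p)n + p − n − 1 = mn + n(p−1) + (p−1)`);
* the resulting any-field floors for the formats with all dimensions `≤ 5` where this is the best
  bound the tree has (BCS Rem. (17.13)(3): use the best ordering, via
  `tensorRank_matMulTensor_rotate` / `_transpose`): `R(⟨2,2,3⟩) ≥ 10`, `⟨2,2,4⟩ ≥ 13`,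
  `⟨2,2,5⟩ ≥ 16`, `⟨2,3,3⟩ ≥ 14`, `⟨2,3,4⟩ ≥ 18`, `⟨2,3,5⟩ ≥ 22`, `⟨2,4,4⟩ ≥ 23`, `⟨2,4,5⟩ ≥ 28`,
  `⟨2,5,5⟩ ≥ 34`, `⟨3,4,4⟩ ≥ 27`, `⟨3,4,5⟩ ≥ 33`, `⟨3,5,5⟩ ≥ 39`, `⟨4,5,5⟩ ≥ 44`
  (for `⟨n,m,n⟩`, `m ≥ n ≥ 3`, Bläser 2003 Thm. 14 — `blaser2003_thm14_holds` — is stronger).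

No named facts; everything is PROVED. (The stronger printed statement about `L` is not formalised —
the tree has no notion of quadratic computation; for `c = 2` the bound coincides with Bläser's
`cm + mn + c − m + n − 3` of Bläser 2003, eq. (1).)

## The proof followed (BCS pp. 460–462, Steps 1–4, specialised to bilinear computations)

Let `β = (f_i, g_i, w_i)_{i ∈ ι}` compute `⟨c,m,n⟩`, `x y = ∑ f_i(x) g_i(y) w_i`. By conciseness the
`w_i` span `k^{c×n}`, so their first rows span `k^n`; choose `n − 1` indices `P` whose first rows
are linearly independent and a vector `t ≠ 0` orthogonal to these first rows (BCS Step 1 instead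
changes coordinates on the output so that these rows become unit vectors and `t = e_1`; choosing
`t` avoids the transport). Put `W₁ = span{w_i : i ∈ P}` and `V₁ = {y ∈ k^{m×n} : y t = 0}`
(`dim V₁ ≥ m(n−1)`). Two properties of `W₁` are used: (N1) an element of `W₁` with vanishing first
row is `0` (independence of the first rows); (N2) the first row of every element of `W₁` is
orthogonal to `t`. Then, in the language of Bläser 2003 §2 as formalised in
`SmallFormatRankSubstitution.lean` (`Separates`, Lemma 3, Extension Lemma), `β` separates
`(k^{c×m}, V₁, W₁)`: starting from `(0, 0, W₁)`, three applications of the Extension Lemma are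
refuted by matrix units exactly as in BCS Steps 2–4 — (Step 2) `k^{c×m} y ⊆ W₁` forces `y = 0` by
(N1) applied to `E_{2μ} y`; (Step 3) for `x` with zero first row, `x(E_{μj₀} − y₁) ∈ W₁` with
`y₁ ∈ V₁` forces `x E_{μ j₀} = x y₁` by (N1), and pairing the rows with `t` gives `x_{iμ} t_{j₀} = 0`;
(Step 4) for `x` with non-zero first row, (N2) applied to `x(E_{μj₀} − y₁)` gives
`x_{1μ} t_{j₀} = 0`. Lemma 3 then gives `|ι| ≥ cm + dim V₁ + |P| ≥ cm + m(n−1) + (n−1)`.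

## References

* P. Bürgisser, M. Clausen, M. A. Shokrollahi, *Algebraic Complexity Theory*, Grundlehren 315,
  Springer 1997: Thm. (17.12) and its proof (pp. 460–462), Rem. (17.13)(3), (14.8) `L ≤ R`.
  [BurgisserClausenShokrollahi1997]
* J.-C. Lafon, S. Winograd, *A lower bound for the multiplicative complexity of the product of two
  matrices*, Centre de Calcul de l'Esplanade, U.E.R. de Mathématique, Univ. Louis Pasteur,
  Strasbourg (1978) (the original, as credited by BCS).
* M. Bläser, *On the complexity of the multiplication of matrices of small formats*,
  J. Complexity 19 (2003) 43–60, §2 (the substitution-method vocabulary used here) and eq. (1).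
  [Blaser2003]
-/

namespace Literature.Computability.AlgebraicComplexity

open Module Matrix

namespace LafonWinograd

variable {k : Type*} [Field k]

/-! ### Pairing the rows of a matrix with a fixed vector -/

/-- `rowDot t x = x t`, i.e. `(rowDot t x) i = ∑_j x_{ij} t_j`: the rows of `x` paired with the fixed
vector `t`, as a linear map in `x`. [folklore] -/
def rowDot {e n : ℕ} (t : Fin n → k) : Matrix (Fin e) (Fin n) k →ₗ[k] (Fin e → k) where
  toFun x := fun i => ∑ j, x i j * t j
  map_add' x y := by
    funext i
    simp [add_mul, Finset.sum_add_distrib]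
  map_smul' a x := by
    funext i
    simp [Finset.mul_sum, mul_assoc]

/-- Unfolding `rowDot`. [folklore] -/
private theorem rowDot_apply {e n : ℕ} (t : Fin n → k) (x : Matrix (Fin e) (Fin n) k) (i : Fin e) :
    rowDot t x i = ∑ j, x i j * t j := rfl

/-- `(x y) t = x (y t)`. [folklore] -/
private theorem rowDot_mul {e m n : ℕ} (t : Fin n → k) (x : Matrix (Fin e) (Fin m) k)
    (y : Matrix (Fin m) (Fin n) k) (i : Fin e) :
    rowDot t (x * y) i = ∑ κ, x i κ * rowDot t y κ := by
  simp only [rowDot_apply, Matrix.mul_apply, Finset.sum_mul, Finset.mul_sum]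
  rw [Finset.sum_comm]
  exact Finset.sum_congr rfl fun κ _ => Finset.sum_congr rfl fun j _ => by ring

/-- `(x E_{μ j₀}) t` has `i`-th entry `x_{iμ} t_{j₀}`. [folklore] -/
private theorem rowDot_mul_single {e m n : ℕ} (t : Fin n → k) (x : Matrix (Fin e) (Fin m) k) (μ : Fin m)
    (j₀ : Fin n) (i : Fin e) :
    rowDot t (x * Matrix.single μ j₀ (1 : k)) i = x i μ * t j₀ := by
  simp only [rowDot_apply, mul_single_apply']
  rw [Finset.sum_eq_single j₀]
  · simp
  · intro j _ hj
    simp [hj]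
  · intro h
    exact absurd (Finset.mem_univ _) h

/-- `dim {y ∈ k^{m×n} : y t = 0} ≥ m(n−1)` (rank–nullity: the image of `y ↦ y t` lies in `k^m`);
BCS proof of Thm. (17.12), Step 2: "Note that [the subspace] has dimension `(p−1)n`."
[cite: BurgisserClausenShokrollahi1997, Thm (17.12) (proof, Step 2)] -/
theorem le_finrank_ker_rowDot {m n : ℕ} (t : Fin n → k) :
    m * (n - 1) ≤ finrank k (LinearMap.ker (rowDot (k := k) (e := m) t)) := by
  have h := LinearMap.finrank_range_add_finrank_ker (rowDot (k := k) (e := m) t)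
  have hr : finrank k (LinearMap.range (rowDot (k := k) (e := m) t)) ≤ m := by
    calc finrank k (LinearMap.range (rowDot (k := k) (e := m) t)) ≤ finrank k (Fin m → k) :=
          Submodule.finrank_le _
      _ = m := by rw [Module.finrank_pi, Fintype.card_fin]
  have htot : finrank k (Matrix (Fin m) (Fin n) k) = m * n := by
    rw [Module.finrank_matrix]
    simp
  rw [htot] at h
  rw [Nat.mul_sub_one]
  omega

/-! ### Choice of `n − 1` outputs with independent first rows and of the vector `t` -/

/-- From a family of vectors spanning `k^n` (`n ≥ 1`) one can pick `n − 1` linearly independent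
members and a non-zero vector `t` orthogonal to all of them (a basis among the family, minus one
member; `t` = a non-zero linear form vanishing on the span of the others). This replaces BCS's
Step 1 ("we may w.l.o.g. assume that `τ(w_1), …, τ(w_p)` form a basis of `U_1`" followed by the
change of basis `T`). [cite: BurgisserClausenShokrollahi1997, Thm (17.12) (proof, Step 1)] -/
theorem exists_indep_and_normal {ι : Type*} [Fintype ι] {n : ℕ} (hn : 1 ≤ n) (r : ι → Fin n → k)
    (hr : Submodule.span k (Set.range r) = ⊤) :
    ∃ (P : Finset ι) (t : Fin n → k), P.card = n - 1 ∧
      LinearIndependent k (fun i : P => r i) ∧ t ≠ 0 ∧ ∀ i ∈ P, ∑ j, r i j * t j = 0 := by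
  classical
  obtain ⟨b, -, -, hsp, hli⟩ :=
    exists_linearIndepOn_extension (linearIndepOn_empty k r) (Set.empty_subset (Set.univ : Set ι))
  have hbfin : b.Finite := Set.toFinite b
  set B : Finset ι := hbfin.toFinset with hBdef
  have hBb : (B : Set ι) = b := hbfin.coe_toFinset
  -- independence of the family on `B`
  have hliB : LinearIndependent k (fun i : B => r i) := by
    have h1 : LinearIndepOn k r (B : Set ι) := by
      rw [hBb]
      exact hli
    exact h1
  -- the family on `B` spans everything
  have hrange : Set.range (fun i : B => r i) = r '' b := by
    ext x
    simp only [Set.mem_range, Set.mem_image, Subtype.exists, exists_prop]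
    constructor
    · rintro ⟨i, hi, rfl⟩
      exact ⟨i, by rw [← hBb]; exact Finset.mem_coe.2 hi, rfl⟩
    · rintro ⟨i, hi, rfl⟩
      exact ⟨i, by rw [← Finset.mem_coe, hBb]; exact hi, rfl⟩
  have hspanB : Submodule.span k (Set.range fun i : B => r i) = ⊤ := by
    rw [hrange, eq_top_iff, ← hr, Submodule.span_le]
    rintro _ ⟨i, rfl⟩
    exact hsp ⟨i, Set.mem_univ _, rfl⟩
  -- hence `|B| = n`
  have hcard : B.card = n := by
    have h1 := linearIndependent_iff_card_eq_finrank_span.1 hliB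
    rw [Set.finrank, hspanB, finrank_top, Module.finrank_pi, Fintype.card_fin,
      Fintype.card_coe] at h1
    exact h1
  -- drop one member
  obtain ⟨i₀, hi₀⟩ : B.Nonempty := by
    rw [← Finset.card_pos, hcard]
    exact hn
  set P : Finset ι := B.erase i₀ with hPdef
  have hPB : P ⊆ B := Finset.erase_subset i₀ B
  have hPcard : P.card = n - 1 := by
    rw [hPdef, Finset.card_erase_of_mem hi₀, hcard]
  have hliP : LinearIndependent k (fun i : P => r i) := by
    have hinj : Function.Injective (fun i : P => (⟨i.1, hPB i.2⟩ : B)) := by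
      intro i j h
      exact Subtype.ext (by simpa using congrArg Subtype.val h)
    exact hliB.comp _ hinj
  -- the span `H` of the remaining members is a proper subspace
  set H : Submodule k (Fin n → k) := Submodule.span k (r '' (P : Set ι)) with hHdef
  have hHlt : H < ⊤ := by
    apply Submodule.lt_top_of_finrank_lt_finrank
    have h1 : finrank k H ≤ (P.image r).card := by
      have := finrank_span_finset_le_card (R := k) (M := Fin n → k) (P.image r)
      rw [Set.finrank, Finset.coe_image] at this
      exact this
    have h2 : (P.image r).card ≤ P.card := Finset.card_image_le
    rw [Module.finrank_pi, Fintype.card_fin]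
    omega
  obtain ⟨f, hf0, hHf⟩ := Submodule.exists_le_ker_of_lt_top H hHlt
  -- the vector `t` representing `f`
  let t : Fin n → k := fun j => f fun j' => if j = j' then 1 else 0
  have hft : ∀ x : Fin n → k, f x = ∑ j, x j * t j := by
    intro x
    rw [LinearMap.pi_apply_eq_sum_univ f x]
    simp [t, smul_eq_mul]
  refine ⟨P, t, hPcard, hliP, ?_, ?_⟩
  · intro ht
    apply hf0
    apply LinearMap.ext
    intro x
    rw [LinearMap.zero_apply, hft x]
    simp [ht]
  · intro i hi
    rw [← hft]
    have hmem : r i ∈ H := Submodule.subset_span ⟨i, hi, rfl⟩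
    exact LinearMap.mem_ker.1 (hHf hmem)

/-! ### The separation `(k^{c×m}, V₁, W₁)` (BCS Steps 2–4) -/

section Separation

variable {c m n : ℕ} {ι : Type*} [Fintype ι]

omit [Fintype ι] in
/-- (N1) If the first rows of the `w_i`, `i ∈ P`, are linearly independent, then an element of
`W₁ = span{w_i : i ∈ P}` with vanishing first row is `0` (BCS Step 1: `∑_{i<p} k w_i ⊕ ⊡ = k^{m×p}`,
"take images under `τ` and use (A)"). [cite: BurgisserClausenShokrollahi1997, Thm (17.12) (proof, Step 1)] -/
theorem eq_zero_of_mem_span_of_row_zero (hc : 0 < c) (w : ι → Matrix (Fin c) (Fin n) k)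
    (P : Finset ι) (hli : LinearIndependent k (fun i : P => w i ⟨0, hc⟩))
    {x : Matrix (Fin c) (Fin n) k} (hx : x ∈ Submodule.span k (w '' (P : Set ι)))
    (hrow : ∀ j, x ⟨0, hc⟩ j = 0) : x = 0 := by
  classical
  rw [Submodule.mem_span_image_finset_iff_exists_fun'] at hx
  obtain ⟨cf, hcf⟩ := hx
  -- the first row of `x` is the corresponding combination of first rows
  have hrow' : ∑ i : P, cf i • w i ⟨0, hc⟩ = 0 := by
    funext j
    have h1 : ∑ i ∈ P, cf i * w i ⟨0, hc⟩ j = 0 := by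
      have h2 := congrFun (congrFun hcf ⟨0, hc⟩) j
      rw [Matrix.sum_apply] at h2
      simp only [Matrix.smul_apply, smul_eq_mul] at h2
      rw [h2]
      exact hrow j
    simp only [Finset.sum_apply, Pi.smul_apply, smul_eq_mul, Pi.zero_apply, Finset.univ_eq_attach]
    rw [Finset.sum_attach P (fun i => cf i * w i ⟨0, hc⟩ j)]
    exact h1
  have hzero : ∀ i : P, cf i = 0 := Fintype.linearIndependent_iff.1 hli (fun i => cf i) hrow'
  rw [← hcf, ← Finset.sum_coe_sort]
  exact Finset.sum_eq_zero fun i _ => by simp [hzero i]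

/-- **BCS Thm. (17.12), proof, Steps 2–4 (bilinear case).** With `P`, `t` as above
(`t ≠ 0`, first rows of the `w_i`, `i ∈ P`, independent and orthogonal to `t`), every bilinear
computation of `⟨c,m,n⟩` with `c ≥ 2` separates `(k^{c×m}, {y : y t = 0}, span{w_i : i ∈ P})`.
[cite: BurgisserClausenShokrollahi1997, Thm (17.12) (proof, Steps 2–4)] -/
theorem separates (β : BilinComp (mulBilin k c m n) ι) (hc : 2 ≤ c) (P : Finset ι)
    (t : Fin n → k) (hli : LinearIndependent k (fun i : P => β.w i ⟨0, by omega⟩))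
    (ht : t ≠ 0) (hperp : ∀ i ∈ P, ∑ j, β.w i ⟨0, by omega⟩ j * t j = 0) :
    β.Separates ⊤ (LinearMap.ker (rowDot (k := k) (e := m) t))
      (Submodule.span k (β.w '' (P : Set ι))) := by
  classical
  have hc0 : 0 < c := by omega
  set W₁ : Submodule k (Matrix (Fin c) (Fin n) k) := Submodule.span k (β.w '' (P : Set ι)) with hW₁
  set V₁ : Submodule k (Matrix (Fin m) (Fin n) k) := LinearMap.ker (rowDot (k := k) (e := m) t)
    with hV₁
  obtain ⟨j₀, hj₀⟩ : ∃ j₀, t j₀ ≠ 0 := by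
    by_contra h
    push Not at h
    exact ht (funext h)
  -- (N1) and (N2)
  have N1 : ∀ x ∈ W₁, (∀ j, x ⟨0, hc0⟩ j = 0) → x = 0 := fun x hx hrow =>
    eq_zero_of_mem_span_of_row_zero hc0 β.w P hli hx hrow
  have N2 : ∀ x ∈ W₁, rowDot t x ⟨0, hc0⟩ = 0 := by
    intro x hx
    have hle : W₁ ≤ LinearMap.ker ((LinearMap.proj ⟨0, hc0⟩).comp (rowDot (k := k) (e := c) t)) := by
      rw [hW₁, Submodule.span_le]
      rintro _ ⟨i, hi, rfl⟩
      simp only [SetLike.mem_coe, LinearMap.mem_ker, LinearMap.coe_comp, Function.comp_apply,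
        LinearMap.coe_proj, Function.eval, rowDot_apply]
      exact hperp i hi
    have := hle hx
    simpa using this
  have hV₁mem : ∀ y ∈ V₁, rowDot t y = 0 := fun y hy => LinearMap.mem_ker.1 hy
  -- Step 0: `(0, 0, W₁)`
  have h0 : β.Separates ⊥ ⊥ W₁ := β.separates_bot_bot W₁
  -- Step 2 of BCS: `(0, V₁, W₁)`
  have h1 : β.Separates ⊥ V₁ W₁ := by
    rcases h0.extension_right (V₂ := V₁) with h | ⟨y, -, hy0, hy⟩
    · exact h
    · exfalso
      apply hy0
      rw [Submodule.mem_bot]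
      ext μ j
      obtain ⟨x₁, hx₁, hmem⟩ := hy (Matrix.single ⟨1, hc⟩ μ 1)
      rw [Submodule.mem_bot] at hx₁
      subst hx₁
      simp only [mulBilin_apply, map_zero, LinearMap.zero_apply, sub_zero] at hmem
      have hrow : ∀ j', (Matrix.single (⟨1, hc⟩ : Fin c) μ (1 : k) * y) ⟨0, hc0⟩ j' = 0 := by
        intro j'
        rw [single_mul_apply']
        simp [Fin.ext_iff]
      have hz := N1 _ hmem hrow
      have := congrFun (congrFun hz ⟨1, hc⟩) j
      simpa [single_mul_apply'] using this
  -- Step 3 of BCS: `(R, V₁, W₁)` with `R` = matrices with zero first row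
  have h2 : β.Separates (rowZero k c m) V₁ W₁ := by
    rcases h1.extension_left (U₂ := rowZero k c m) with h | ⟨x, hxR, hx0, hx⟩
    · exact h
    · exfalso
      apply hx0
      rw [Submodule.mem_bot]
      ext i μ
      obtain ⟨y₁, hy₁, hmem⟩ := hx (Matrix.single μ j₀ 1)
      simp only [mulBilin_apply] at hmem
      have hx00 : ∀ κ, x ⟨0, hc0⟩ κ = 0 := fun κ => (mem_rowZero.1 hxR) _ κ rfl
      have hrow : ∀ j, (x * Matrix.single μ j₀ (1 : k) - x * y₁) ⟨0, hc0⟩ j = 0 := by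
        intro j
        simp [Matrix.sub_apply, Matrix.mul_apply, hx00]
      have hz := N1 _ hmem hrow
      have heq : x * Matrix.single μ j₀ (1 : k) = x * y₁ := sub_eq_zero.1 hz
      have h3 : rowDot t (x * Matrix.single μ j₀ (1 : k)) i = 0 := by
        rw [heq, rowDot_mul, hV₁mem y₁ hy₁]
        simp
      rw [rowDot_mul_single] at h3
      exact (mul_eq_zero.1 h3).resolve_right hj₀
  -- Step 4 of BCS: `(k^{c×m}, V₁, W₁)`
  rcases h2.extension_left (U₂ := ⊤) with h | ⟨x, -, hxR, hx⟩
  · exact h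
  · exfalso
    apply hxR
    rw [mem_rowZero]
    intro i μ hi
    have hi' : i = ⟨0, hc0⟩ := Fin.ext hi
    rw [hi']
    obtain ⟨y₁, hy₁, hmem⟩ := hx (Matrix.single μ j₀ 1)
    simp only [mulBilin_apply] at hmem
    have h4 := N2 _ hmem
    rw [map_sub, Pi.sub_apply, rowDot_mul_single, rowDot_mul] at h4
    simp only [hV₁mem y₁ hy₁, Pi.zero_apply, mul_zero, Finset.sum_const_zero, sub_zero] at h4
    exact (mul_eq_zero.1 h4).resolve_right hj₀

/-- The first row of an output matrix, as a linear map. [folklore] -/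
def row0 (hc : 0 < c) : Matrix (Fin c) (Fin n) k →ₗ[k] (Fin n → k) where
  toFun x := fun j => x ⟨0, hc⟩ j
  map_add' _ _ := rfl
  map_smul' _ _ := rfl

/-- The first rows of the outputs `w_i` of a computation of `⟨c,m,n⟩` (`m ≥ 1`) span `k^n`
(conciseness: the `w_i` span `k^{c×n}`, Bläser 2003 p. 52 / BCS Step 1 "since `φ` is 3-concise,
`w_1, …, w_ℓ` generate `k^{m×p}`"). [cite: BurgisserClausenShokrollahi1997, Thm (17.12) (proof, Step 1)] -/
theorem span_row0_w_eq_top (β : BilinComp (mulBilin k c m n) ι) (hc : 0 < c) (hm : 0 < m) :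
    Submodule.span k (Set.range fun i => row0 (k := k) (n := n) hc (β.w i)) = ⊤ := by
  have hw := β.span_w_eq_top hm
  have hcomp : (Set.range fun i => row0 (k := k) (n := n) hc (β.w i)) =
      row0 (k := k) (n := n) hc '' Set.range β.w := by
    rw [← Set.range_comp]
    rfl
  rw [hcomp, Submodule.span_image, hw, Submodule.map_top, LinearMap.range_eq_top]
  intro v
  refine ⟨Matrix.of fun i j => if i = ⟨0, hc⟩ then v j else 0, ?_⟩
  funext j
  simp [row0]

/-- **BCS Thm. (17.12) for bilinear computations.** Every bilinear computation of `⟨c,m,n⟩`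
(`c ≥ 2`, `m, n ≥ 1`) over a field has length at least `cm + m(n−1) + (n−1)`.
[cite: BurgisserClausenShokrollahi1997, Thm (17.12)] -/
theorem card_ge (β : BilinComp (mulBilin k c m n) ι) (hc : 2 ≤ c) (hm : 1 ≤ m) (hn : 1 ≤ n) :
    c * m + m * (n - 1) + (n - 1) ≤ Fintype.card ι := by
  classical
  have hc0 : 0 < c := by omega
  obtain ⟨P, t, hPcard, hli, ht, hperp⟩ :=
    exists_indep_and_normal hn (fun i => row0 (k := k) (n := n) hc0 (β.w i))
      (span_row0_w_eq_top β hc0 hm)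
  have hsep := separates β hc P t hli ht hperp
  have hcount := hsep.finrank_add_finrank_add_card_le P
    (fun i hi => Submodule.subset_span ⟨i, hi, rfl⟩)
  have htop : finrank k (⊤ : Submodule k (Matrix (Fin c) (Fin m) k)) = c * m := by
    rw [finrank_top, Module.finrank_matrix]
    simp
  have hker := le_finrank_ker_rowDot (k := k) (m := m) t
  rw [htop, hPcard] at hcount
  omega

end Separation

end LafonWinograd

/-! ### The rank statements -/

/-- **Lafon–Winograd bound, rank form, every field** (BCS 1997, Thm. (17.12) with (14.8) `L ≤ R`):
for `c ≥ 2` and `m, n ≥ 1`, `R(⟨c,m,n⟩) ≥ cm + m(n−1) + (n−1)` (`= cm + mn + n − m − 1`).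
[cite: BurgisserClausenShokrollahi1997, Thm (17.12)] -/
theorem lafonWinograd_le_tensorRank_matMulTensor (k : Type*) [Field k] {c m n : ℕ} (hc : 2 ≤ c)
    (hm : 1 ≤ m) (hn : 1 ≤ n) :
    c * m + m * (n - 1) + (n - 1) ≤ tensorRank (matMulTensor k c m n) := by
  obtain ⟨β⟩ := exists_bilinComp_of_tensorRank_le (k := k) (c := c) (m := m) (n := n) le_rfl
  simpa [Fintype.card_fin] using LafonWinograd.card_ge β hc hm hn

/-- **Bürgisser–Clausen–Shokrollahi 1997, Thm. (17.12) (Lafon and Winograd), as printed, for the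
rank**: for integers `m, n, p ≥ 2`, `R(⟨m,n,p⟩) ≥ (m + p)n + p − n − 1` over every field (printed
for the multiplicative complexity `L ≤ R`). [cite: BurgisserClausenShokrollahi1997, Thm (17.12)] -/
theorem BCS1997_thm_17_12_rank (k : Type*) [Field k] {m n p : ℕ} (hm : 2 ≤ m) (hn : 2 ≤ n)
    (hp : 2 ≤ p) : (m + p) * n + p - n - 1 ≤ tensorRank (matMulTensor k m n p) := by
  have h := lafonWinograd_le_tensorRank_matMulTensor k (c := m) (m := n) (n := p) hm
    (by omega) (by omega)
  have h1 : (m + p) * n = m * n + p * n := Nat.add_mul m p n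
  have h2 : n * (p - 1) = n * p - n := Nat.mul_sub_one n p
  have h3 : p * n = n * p := Nat.mul_comm p n
  have h4 : n ≤ n * p := Nat.le_mul_of_pos_right n (by omega)
  rw [h2] at h
  rw [h1, h3]
  omega

/-! ### The any-field floors for the small formats (all dimensions `≤ 5`)

BCS Rem. (17.13)(3): the rank is invariant under permuting the format, so one takes the best of the
orderings (`tensorRank_matMulTensor_rotate`, `tensorRank_matMulTensor_transpose`,
`KroneckerRank.lean`). The formats `⟨3,3,3⟩, ⟨3,3,4⟩, ⟨3,3,5⟩, ⟨4,4,4⟩, ⟨4,4,5⟩, ⟨5,5,5⟩` are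
omitted: there Bläser 2003, Thm. 14 / Cor. 9 (`blaser2003_thm14_holds`) is stronger. -/

section SmallFormats

variable (k : Type*) [Field k]

/-- `R(⟨2,2,3⟩) ≥ 10` over every field (Lafon–Winograd / Bläser 2003 eq. (1)).
[cite: BurgisserClausenShokrollahi1997, Thm (17.12)] -/
theorem ten_le_tensorRank_matMulTensor_223 : 10 ≤ tensorRank (matMulTensor k 2 2 3) := by
  simpa using lafonWinograd_le_tensorRank_matMulTensor k (c := 2) (m := 2) (n := 3)
    (by norm_num) (by norm_num) (by norm_num)

/-- `R(⟨2,2,4⟩) ≥ 13` over every field. [cite: BurgisserClausenShokrollahi1997, Thm (17.12)] -/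
theorem thirteen_le_tensorRank_matMulTensor_224 : 13 ≤ tensorRank (matMulTensor k 2 2 4) := by
  simpa using lafonWinograd_le_tensorRank_matMulTensor k (c := 2) (m := 2) (n := 4)
    (by norm_num) (by norm_num) (by norm_num)

/-- `R(⟨2,2,5⟩) ≥ 16` over every field. [cite: BurgisserClausenShokrollahi1997, Thm (17.12)] -/
theorem sixteen_le_tensorRank_matMulTensor_225 : 16 ≤ tensorRank (matMulTensor k 2 2 5) := by
  simpa using lafonWinograd_le_tensorRank_matMulTensor k (c := 2) (m := 2) (n := 5)
    (by norm_num) (by norm_num) (by norm_num)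

/-- `R(⟨2,3,3⟩) ≥ 14` over every field ("(1) yields `R(⟨2,3,3⟩) ≥ 14`", Bläser 2003 p. 45).
[cite: BurgisserClausenShokrollahi1997, Thm (17.12)] -/
theorem fourteen_le_tensorRank_matMulTensor_233 : 14 ≤ tensorRank (matMulTensor k 2 3 3) := by
  simpa using lafonWinograd_le_tensorRank_matMulTensor k (c := 2) (m := 3) (n := 3)
    (by norm_num) (by norm_num) (by norm_num)

/-- `R(⟨2,3,4⟩) ≥ 18` over every field. [cite: BurgisserClausenShokrollahi1997, Thm (17.12)] -/
theorem eighteen_le_tensorRank_matMulTensor_234 : 18 ≤ tensorRank (matMulTensor k 2 3 4) := by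
  simpa using lafonWinograd_le_tensorRank_matMulTensor k (c := 2) (m := 3) (n := 4)
    (by norm_num) (by norm_num) (by norm_num)

/-- `R(⟨2,3,5⟩) ≥ 22` over every field. [cite: BurgisserClausenShokrollahi1997, Thm (17.12)] -/
theorem twentytwo_le_tensorRank_matMulTensor_235 : 22 ≤ tensorRank (matMulTensor k 2 3 5) := by
  simpa using lafonWinograd_le_tensorRank_matMulTensor k (c := 2) (m := 3) (n := 5)
    (by norm_num) (by norm_num) (by norm_num)

/-- `R(⟨2,4,4⟩) ≥ 23` over every field. [cite: BurgisserClausenShokrollahi1997, Thm (17.12)] -/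
theorem twentythree_le_tensorRank_matMulTensor_244 : 23 ≤ tensorRank (matMulTensor k 2 4 4) := by
  simpa using lafonWinograd_le_tensorRank_matMulTensor k (c := 2) (m := 4) (n := 4)
    (by norm_num) (by norm_num) (by norm_num)

/-- `R(⟨2,4,5⟩) ≥ 28` over every field. [cite: BurgisserClausenShokrollahi1997, Thm (17.12)] -/
theorem twentyeight_le_tensorRank_matMulTensor_245 : 28 ≤ tensorRank (matMulTensor k 2 4 5) := by
  simpa using lafonWinograd_le_tensorRank_matMulTensor k (c := 2) (m := 4) (n := 5)
    (by norm_num) (by norm_num) (by norm_num)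

/-- `R(⟨2,5,5⟩) ≥ 34` over every field. [cite: BurgisserClausenShokrollahi1997, Thm (17.12)] -/
theorem thirtyfour_le_tensorRank_matMulTensor_255 : 34 ≤ tensorRank (matMulTensor k 2 5 5) := by
  simpa using lafonWinograd_le_tensorRank_matMulTensor k (c := 2) (m := 5) (n := 5)
    (by norm_num) (by norm_num) (by norm_num)

/-- `R(⟨3,4,4⟩) ≥ 27` over every field. [cite: BurgisserClausenShokrollahi1997, Thm (17.12)] -/
theorem twentyseven_le_tensorRank_matMulTensor_344 : 27 ≤ tensorRank (matMulTensor k 3 4 4) := by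
  simpa using lafonWinograd_le_tensorRank_matMulTensor k (c := 3) (m := 4) (n := 4)
    (by norm_num) (by norm_num) (by norm_num)

/-- `R(⟨3,4,5⟩) ≥ 33` over every field, from the ordering `⟨3,5,4⟩` (BCS Rem. (17.13)(3)).
[cite: BurgisserClausenShokrollahi1997, Thm (17.12) and Rem (17.13)(3)] -/
theorem thirtythree_le_tensorRank_matMulTensor_345 : 33 ≤ tensorRank (matMulTensor k 3 4 5) := by
  have h := lafonWinograd_le_tensorRank_matMulTensor k (c := 3) (m := 5) (n := 4)
    (by norm_num) (by norm_num) (by norm_num)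
  rw [tensorRank_matMulTensor_rotate, tensorRank_matMulTensor_transpose]
  simpa using h

/-- `R(⟨3,5,5⟩) ≥ 39` over every field. [cite: BurgisserClausenShokrollahi1997, Thm (17.12)] -/
theorem thirtynine_le_tensorRank_matMulTensor_355 : 39 ≤ tensorRank (matMulTensor k 3 5 5) := by
  simpa using lafonWinograd_le_tensorRank_matMulTensor k (c := 3) (m := 5) (n := 5)
    (by norm_num) (by norm_num) (by norm_num)

/-- `R(⟨4,5,5⟩) ≥ 44` over every field. [cite: BurgisserClausenShokrollahi1997, Thm (17.12)] -/
theorem fortyfour_le_tensorRank_matMulTensor_455 : 44 ≤ tensorRank (matMulTensor k 4 5 5) := by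
  simpa using lafonWinograd_le_tensorRank_matMulTensor k (c := 4) (m := 5) (n := 5)
    (by norm_num) (by norm_num) (by norm_num)

end SmallFormats

end Literature.Computability.AlgebraicComplexity
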